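import Mathlib
import Literature.Analysis.FluidPDE.AxisymmetricVorticityTransport
import HarnessLib.Audit
import HarnessLib

/-!
# L3TimeExponentPincer — symmetry and size bookkeeping of the parabolic normalisation `y ↦ c·u(c²t, c·y − x₀)`

Support kernel for the crux `L3CascadeJaw` (item stmt-NavierStokesRegularity-19499) of route
`L3TimeExponentPincer`; algebra for step 1 (normalisation) of the compactness reduction (J)
`CritSmoothingNoSwirlB ⇐ (SFL³)` of planner nsreg-p2's ROUND-12 §2b (blueprint attached to the
item).  The tree's Kato covariance `kato_local_rescale_translate` (KatoLocalCovariance.lean)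
normalises a solution by `w(t, y) = c • u(c² t, c • y - x₀)`, datum `y ↦ c • u₀(c • y - x₀)`; this
file records what the normalisation does to the symmetry axis and to the blow-up datum:

* `rescaled_axisymmetricAbout` — if `u₀` is axisymmetric about the `x₂`-axis through the origin
  (`IsAxisymmetric`), then `y ↦ c • u₀(c • y - x₀)` is axisymmetric about the vertical axis through
  `a = c⁻¹ • x₀` in the «about» form `w₀(a + R_θ(y - a)) = R_θ (w₀ y)` of `…RecedingAxis` /
  `…ConvergingAxes`;
* `rescaled_swirlAbout_eq_zero` — if `u₀` is swirl-free (`HasNoSwirl`), the swirl of the normalised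
  field about that axis vanishes;
* `cylRadius_inv_smul` — the distance of the new axis from the origin is `cylRadius x₀ / c`;
* `lt_norm_smul_of_lt` — with `c = √t`, `k·t^{-1/2} < ‖u(t,x)‖` becomes `k < ‖c • u(t,x)‖ = ‖w(1, 0)‖`
  for `x₀ = -x`.

WHAT THIS IS NOT: not NS regularity or blow-up; algebra; the crux `L3CascadeJaw` is untouched; no
crux claim.
-/

noncomputable section

open MeasureTheory Set Function Filter

namespace Summit.NavierStokesRegularity.NavierStokesRegularity.Theorems.L3TimeExponentPincerRescaledSymmetry

open Literature.Analysis.FluidPDE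

/-- `c • a - x₀ = 0` for `a = c⁻¹ • x₀`, `c ≠ 0`. -/
theorem smul_inv_smul_sub_self {c : ℝ} (hc : c ≠ 0) (x₀ : EuclideanSpace ℝ (Fin 3)) :
    c • (c⁻¹ • x₀) - x₀ = 0 := by
  rw [smul_smul, mul_inv_cancel₀ hc, one_smul, sub_self]

/-- The argument of the normalised field at `a + R_θ(y - a)`, `a = c⁻¹ • x₀`:
`c • (a + R_θ(y - a)) - x₀ = R_θ (c • y - x₀)`. -/
theorem rescaled_arg_rotZ_about {c : ℝ} (hc : c ≠ 0) (x₀ : EuclideanSpace ℝ (Fin 3)) (θ : ℝ)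
    (y : EuclideanSpace ℝ (Fin 3)) :
    c • ((c⁻¹ • x₀) + rotZ θ (y - c⁻¹ • x₀)) - x₀ = rotZ θ (c • y - x₀) := by
  have h1 : c • y - x₀ = c • (y - c⁻¹ • x₀) := by
    rw [smul_sub, smul_smul, mul_inv_cancel₀ hc, one_smul]
  rw [h1, smul_add, ← rotZL_apply, ← rotZL_apply, ← map_smul, smul_smul, mul_inv_cancel₀ hc,
    one_smul, add_sub_cancel_left]

/-- **The normalised datum is axisymmetric about the vertical axis through `c⁻¹ • x₀`.**  If
`u₀ (R_θ z) = R_θ (u₀ z)` for all `θ`, `z` (axis through the origin), then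
`w₀ y = c • u₀ (c • y - x₀)` satisfies `w₀ (a + R_θ (y - a)) = R_θ (w₀ y)` with `a = c⁻¹ • x₀`. -/
theorem rescaled_axisymmetricAbout {u₀ : EuclideanSpace ℝ (Fin 3) → EuclideanSpace ℝ (Fin 3)}
    (hu : IsAxisymmetric u₀) {c : ℝ} (hc : c ≠ 0) (x₀ : EuclideanSpace ℝ (Fin 3)) (θ : ℝ)
    (y : EuclideanSpace ℝ (Fin 3)) :
    c • u₀ (c • ((c⁻¹ • x₀) + rotZ θ (y - c⁻¹ • x₀)) - x₀) = rotZ θ (c • u₀ (c • y - x₀)) := by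
  rw [rescaled_arg_rotZ_about hc, hu θ, ← rotZL_apply, ← rotZL_apply, map_smul]

/-- Time-dependent version for the slices of the normalised solution
`w t y = c • u (c² t) (c • y - x₀)`: axisymmetry of the slice `u (c² t)` about the origin axis gives
axisymmetry of `w t` about the axis through `c⁻¹ • x₀`. -/
theorem rescaled_slice_axisymmetricAbout
    {u : ℝ → EuclideanSpace ℝ (Fin 3) → EuclideanSpace ℝ (Fin 3)} {c : ℝ} (hc : c ≠ 0)
    (x₀ : EuclideanSpace ℝ (Fin 3)) {t : ℝ} (hu : IsAxisymmetric (u (c ^ 2 * t))) (θ : ℝ)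
    (y : EuclideanSpace ℝ (Fin 3)) :
    c • u (c ^ 2 * t) (c • ((c⁻¹ • x₀) + rotZ θ (y - c⁻¹ • x₀)) - x₀)
      = rotZ θ (c • u (c ^ 2 * t) (c • y - x₀)) :=
  rescaled_axisymmetricAbout hu hc x₀ θ y

/-- The horizontal components of `y - c⁻¹ • x₀` are `c⁻¹` times those of `c • y - x₀`. -/
theorem sub_inv_smul_apply {c : ℝ} (hc : c ≠ 0) (x₀ y : EuclideanSpace ℝ (Fin 3)) (i : Fin 3) :
    (y - c⁻¹ • x₀) i = c⁻¹ * (c • y - x₀) i := by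
  simp only [PiLp.sub_apply, PiLp.smul_apply, smul_eq_mul]
  field_simp

/-- **The normalised datum is swirl-free about the new axis.**  If `swirl u₀ ≡ 0`
(`HasNoSwirl u₀`), then for `w₀ y = c • u₀ (c • y - x₀)` and `a = c⁻¹ • x₀`:
`(y - a)₀ (w₀ y)₁ - (y - a)₁ (w₀ y)₀ = 0`. -/
theorem rescaled_swirlAbout_eq_zero {u₀ : EuclideanSpace ℝ (Fin 3) → EuclideanSpace ℝ (Fin 3)}
    (hu : HasNoSwirl u₀) {c : ℝ} (hc : c ≠ 0) (x₀ y : EuclideanSpace ℝ (Fin 3)) :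
    (y - c⁻¹ • x₀) 0 * (c • u₀ (c • y - x₀)) 1 - (y - c⁻¹ • x₀) 1 * (c • u₀ (c • y - x₀)) 0 = 0 := by
  have h := hu (c • y - x₀)
  rw [swirl] at h
  rw [sub_inv_smul_apply hc, sub_inv_smul_apply hc, PiLp.smul_apply, PiLp.smul_apply, smul_eq_mul,
    smul_eq_mul]
  have : c⁻¹ * (c • y - x₀) 0 * (c * u₀ (c • y - x₀) 1) - c⁻¹ * (c • y - x₀) 1 * (c * u₀ (c • y - x₀) 0)
      = (c⁻¹ * c) * ((c • y - x₀) 0 * u₀ (c • y - x₀) 1 - (c • y - x₀) 1 * u₀ (c • y - x₀) 0) := by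
    ring
  rw [this, h, mul_zero]

/-- Time-dependent version: a swirl-free slice `u (c² t)` gives a slice `w t` swirl-free about the
new axis. -/
theorem rescaled_slice_swirlAbout_eq_zero
    {u : ℝ → EuclideanSpace ℝ (Fin 3) → EuclideanSpace ℝ (Fin 3)} {c : ℝ} (hc : c ≠ 0)
    (x₀ : EuclideanSpace ℝ (Fin 3)) {t : ℝ} (hu : HasNoSwirl (u (c ^ 2 * t)))
    (y : EuclideanSpace ℝ (Fin 3)) :
    (y - c⁻¹ • x₀) 0 * (c • u (c ^ 2 * t) (c • y - x₀)) 1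
      - (y - c⁻¹ • x₀) 1 * (c • u (c ^ 2 * t) (c • y - x₀)) 0 = 0 :=
  rescaled_swirlAbout_eq_zero hu hc x₀ y

/-- **Distance of the new axis from the origin**: `cylRadius (c⁻¹ • x₀) = cylRadius x₀ / c` for
`c > 0`. -/
theorem cylRadius_inv_smul {c : ℝ} (hc : 0 < c) (x₀ : EuclideanSpace ℝ (Fin 3)) :
    cylRadius (c⁻¹ • x₀) = cylRadius x₀ / c := by
  rw [cylRadius_smul, abs_of_pos (inv_pos.2 hc), div_eq_inv_mul]

/-- **The blow-up datum after normalisation**: with `c = √t` (`t > 0`), `k · t^{-1/2} < ‖v‖`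
gives `k < ‖c • v‖` (the value `w(1, 0) = c • u(t, x)` of the normalised field when `x₀ = -x`). -/
theorem lt_norm_smul_of_lt {t k : ℝ} (ht : 0 < t) {v : EuclideanSpace ℝ (Fin 3)}
    (h : k * t ^ (-(1 / 2 : ℝ)) < ‖v‖) : k < ‖Real.sqrt t • v‖ := by
  have hst : 0 < Real.sqrt t := Real.sqrt_pos.2 ht
  rw [norm_smul, Real.norm_of_nonneg hst.le]
  have h1 : t ^ (-(1 / 2 : ℝ)) = (Real.sqrt t)⁻¹ := by
    rw [Real.rpow_neg ht.le, Real.sqrt_eq_rpow]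
  rw [h1] at h
  have h2 := mul_lt_mul_of_pos_left h hst
  rwa [← mul_assoc, mul_comm (Real.sqrt t) k, mul_assoc, mul_inv_cancel₀ hst.ne', mul_one] at h2

/-- The normalised field at `(1, 0)` is `c • u (c², -x₀)`; with `c² = t` and `x₀ = -x` this is
`c • u(t, x)`. -/
theorem rescaled_apply_one_zero (u : ℝ → EuclideanSpace ℝ (Fin 3) → EuclideanSpace ℝ (Fin 3))
    (c : ℝ) (x : EuclideanSpace ℝ (Fin 3)) :
    (fun s (y : EuclideanSpace ℝ (Fin 3)) => c • u (c ^ 2 * s) (c • y - (-x))) 1 0 = c • u (c ^ 2) x := by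
  simp

end Summit.NavierStokesRegularity.NavierStokesRegularity.Theorems.L3TimeExponentPincerRescaledSymmetry

end
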